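import Summits.BirchSwinnertonDyer.BirchSwinnertonDyer.Theorems.ClassRecordThreeCornerAtThreeChaStructureOfImage
import Summits.BirchSwinnertonDyer.BirchSwinnertonDyer.Theorems.ClassRecordThreeShimuraKolyvaginCebotarevOfImageOdd
import Literature.NumberTheory.EllipticCurves.BSDSelmerCMPConverseHeegnerFieldProofs
import HarnessLib

/-!
# Cha 2005 Rmk. 25 ∕ McCallum 1991 Cor. 5.6 (upper half under global divisibility) BY KERNEL at ANY odd multiplicative-or-split `p`
# with `E[p]` irreducible and `−1 ∈ ρ̄_{E,p}(Γ_ℚ)` — the `p ≥ 5` corner twin of `…ChaStructureOfImage` §3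
# (cell `bsd-stepL`, seat `bsd-stepL-corner3-p2` g11 = WIDTH-LEVER lane B; `--supports stmt-BirchSwinnertonDyer-21420 --as helper`;
# offered to lane A corner-p1 for crux 19065 `NonSurjCorner`, whose `stub_katoTwinFactsContra57` cites the same fact at `p ∈ {5, 7}`)

WHY. `ModularHeegnerCha.padicValNat_card_sha_primary_add_le_of_globalDivisibility_ofImage` (this seat g11, p626168) is `p`-GENERIC: it needs only the four
image inputs (hIz) (hIs) (hIc) (hIt) of lane B's machine and ring-class no-`p`-torsion. For ANY odd `p` SPLIT in `K` (e.g. `p ∣ N` on a Heegner frame)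
with `E[p]` irreducible and `−1 ∈ ρ̄_{E,p}(Γ_ℚ)` these hold by shim3b's image-free leaves (Gross 1991 §9 disjointness at a prime `q ∣ d_K`, `q ∤ pN`):
(hIs) `ShimuraKolyvaginImageInputs.hasIrreducibleModPGaloisRep_baseChange`, (hIc) `…exists_eq_zsmul_baseChange_of_irr`, (hIz)
`ShimuraKolyvaginCebotarevOfImageOdd.exists_smul_eq_neg_baseChange_of_exists`, (hIt) `torsionBy_eq_bot_of_isImaginaryQuadratic_of_hasIrreducibleModPGaloisRep`,
and the no-torsion by x11b3's `NoTorsionIrr` (`p` unramified: split). `−1 ∈ ρ̄(Γ_ℚ)` holds for every image containing `SL₂(𝔽_p)` and for the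
Cartan-normaliser images of the non-surjective corner at `5, 7` (shim3b `McCallum1991_cor_3_2_pow_of_irr_of_neg`, module docstring); without it the
Matar–Nekovář error terms appear (not treated).

HONEST FRAMING: ONE THEOREM (no definition, no named fact, no `sorry`, no instance); CONDITIONAL on `casselsTate_levelInputs K`,
`GrossLMS1991.prop37_2_frobeniusCongruence`, `−1 ∈ ρ̄_{E,p}(Γ_ℚ)` and the displayed frame conditions («`2` not inert», `p ∣ N`); nothing booked; no stub
closes; items 21420 ∕ 19065 NOT closed; BSD is proved for no curve; T7. Credit as in `…ChaStructureOfImage`.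
References: [Cha2005] Thm. 21, Rmk. 25; [MatarNekovar2019] Thm. 0.7, §0.11, Prop. 5.26 (2); [McCallumLMS1991] §3 Cor. 3.2, §5 Cor. 5.6;
[GrossLMS1991] §9 (before Prop. 9.1), Prop. 9.3.
presearch: as `…ChaStructureOfImage` (the statements derived are Cha Rmk 25 ∕ MN19 §0.11; nothing in corpus+galaxy proves them for a non-surjective image).
-/

set_option autoImplicit false
set_option linter.dupNamespace false

noncomputable section

open scoped Classical NumberField

namespace Summit.BirchSwinnertonDyer.BirchSwinnertonDyer.Theorems.ModularHeegnerCha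

open WeierstrassCurve Field NumberField IsDedekindDomain
open Literature.NumberTheory.EllipticCurves Literature.NumberTheory.GaloisRepresentations
  Literature.NumberTheory.EllipticCurves.RingClassField Literature.NumberTheory.EllipticCurves.ModularForms
  Summit.BirchSwinnertonDyer.Rank1Residual.X11b
  Summit.BirchSwinnertonDyer.BirchSwinnertonDyer.Theorems.ShimuraKolyvaginOfImage

variable {K : Type} [Field K] [NumberField K] {W : WeierstrassCurve ℚ}

/-- **Cha 2005 Rmk. 25, upper half, at ANY odd `p ∣ N` with `E[p]` irreducible and `−1 ∈ ρ̄_{E,p}(Γ_ℚ)`, BY KERNEL.** `E = W/ℚ` elliptic,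
globally minimal, conductor `N`; `K` imaginary quadratic Heegner for `N` with `d_K ∉ {−3, −4}` and `2` NOT inert; `p` odd, `p ∣ N` (so `p` splits in
`K`), `E[p]` irreducible, `−1 ∈ ρ̄_{E,p}(Γ_ℚ)`; a frame `(Dt, β, ι)` with a conductor-`1` datum `d₁` whose derived point is `P` (infinite order,
`p^{M₀} ∥ P`): if every `P_n` on the frame (square-free `n` on Zhang–Kolyvagin primes of index `≥ s`) is `p^s`-divisible for all `s ≤ t`, then
`ord_p #Ш(E/K)[p^∞] + 2t ≤ 2M₀`. CONDITIONAL on `hCT`, `h372`, `hneg`.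
[cite: Cha2005, Thm. 21 and Rmk. 25 (pp. 173–175)] [cite: MatarNekovar2019, Thm. 0.7, §0.11] [cite: McCallumLMS1991, §5 Cor. 5.6]
[cite: GrossLMS1991, §9 (before Prop. 9.1), Prop. 9.3] -/
theorem cha_rmk25_upper_of_neg_of_casselsTate_of_frobeniusCongruence
    [W.IsElliptic] [W.IsGloballyMinimal] [NeZero (W.conductorNorm ℤ)]
    (hCT : casselsTate_levelInputs K) (h372 : GrossLMS1991.prop37_2_frobeniusCongruence)
    (hK : IsImaginaryQuadratic K) (hD3 : NumberField.discr K ≠ -3) (hD4 : NumberField.discr K ≠ -4)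
    (hH : SatisfiesHeegnerHypothesis (W.conductorNorm ℤ) K)
    (h2 : ¬ (Ideal.span {((2 : ℕ) : 𝓞 K)}).IsPrime)
    {p : ℕ} [Fact p.Prime] (hp2 : p ≠ 2) (hpN : p ∣ W.conductorNorm ℤ)
    (hirr : W.HasIrreducibleModPGaloisRep p)
    (hneg : ∃ γ : absoluteGaloisGroup ℚ, ∀ P : geomTorsion W p, γ • P = -P)
    (ι : K →+* ℂ) (Dt : ModularParametrizationData W (W.conductorNorm ℤ)) {β : ℤ}
    (d₁ : KolyvaginHeegnerData Dt β ι 1) {P : (W.baseChange K).toAffine.Point}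
    (hPd : d₁.toGeomPoints d₁.derivedPoint = toGeomPoints (W.baseChange K) P)
    (hnt : ¬ IsOfFinAddOrder P) {M₀ : ℕ}
    (hM₀div : ∃ Q : (W.baseChange K).toAffine.Point, ((p ^ M₀ : ℕ) : ℤ) • Q = P)
    (hM₀max : ¬ ∃ Q : (W.baseChange K).toAffine.Point, ((p ^ (M₀ + 1) : ℕ) : ℤ) • Q = P)
    (t : ℕ)
    (hglob : ∀ (s : ℕ), s ≤ t → ∀ (n : ℕ) (d : KolyvaginHeegnerData Dt β ι n), Squarefree n →
      (∀ ℓ ∈ n.primeFactors, Zhang2014.IsKolyvaginPrime (W.conductorNorm ℤ) W K p ℓ ∧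
        s ≤ Zhang2014.kolyvaginIndex W p ℓ) →
      ∃ Q : (W.baseChange (ringClassField K ι n)).toAffine.Point, ((p ^ s : ℕ) : ℤ) • Q = d.derivedPoint) :
    padicValNat p (Nat.card (AddCommGroup.primaryComponent (W.baseChange K).sha p)) + 2 * t ≤ 2 * M₀ := by
  have hp : p.Prime := Fact.out
  -- the frame: `p` splits in `K`, hence `p ∤ d_K` and `p` is unramified
  have hsplit : ((Ideal.span {(p : ℤ)}).primesOver (𝓞 K)).ncard = 2 := hH p hp hpN
  have hpd : ¬ (p : ℤ) ∣ NumberField.discr K :=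
    ShimuraKolyvaginImageInputs.not_dvd_discr_of_ncard_primesOver_eq_two K hK.1 hp hsplit
  -- Gross's disjointness prime `q ∣ d_K`, `q ∤ N`, `q ≠ p`
  obtain ⟨q, hq, hqd, hqN⟩ := ShimuraKolyvaginImageInputs.exists_prime_dvd_discr_not_dvd K hK.1
    (N := W.conductorNorm ℤ) (∅ : Finset ℕ) (fun ℓ hℓ ↦ absurd hℓ (Finset.notMem_empty ℓ))
    (fun ℓ hℓ hℓN _ ↦ hH ℓ hℓ hℓN)
  have hqp : ¬ (q : ℤ) ∣ (p : ℤ) := fun h ↦ by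
    have h' : q ∣ p := by exact_mod_cast h
    rcases (Nat.dvd_prime hp).mp h' with h1 | h1
    · exact hq.one_lt.ne' h1
    · exact hpd (h1 ▸ hqd)
  -- the four image inputs at `p` (shim3b's image-free leaves)
  have hIz : ∃ z : absoluteGaloisGroup K, ∀ t : geomTorsion (W.baseChange K) p, z • t = -t :=
    ShimuraKolyvaginCebotarevOfImageOdd.exists_smul_eq_neg_baseChange_of_exists W K hK.1 hq hqd hqN hqp hneg
  have hIs : (W.baseChange K).HasIrreducibleModPGaloisRep p :=
    ShimuraKolyvaginImageInputs.hasIrreducibleModPGaloisRep_baseChange W K hK.1 hq hqd hqN hqp hirr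
  have hIc : ∀ f : geomTorsion (W.baseChange K) p →+ geomTorsion (W.baseChange K) p,
      (∀ (g : absoluteGaloisGroup K) (t : geomTorsion (W.baseChange K) p), f (g • t) = g • f t) →
        ∃ k : ℤ, ∀ t, f t = k • t :=
    fun f hf ↦ ShimuraKolyvaginImageInputs.exists_eq_zsmul_baseChange_of_irr W K hK.1 hq hqd hqN hp2 hqp hirr f hf
  have hIt : AddSubgroup.torsionBy (W.baseChange K).toAffine.Point (p : ℤ) = ⊥ :=
    torsionBy_eq_bot_of_isImaginaryQuadratic_of_hasIrreducibleModPGaloisRep W K hK hp hirr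
  -- no `p`-power torsion over the ring class fields of conductor prime to `p` (x11b3 `NoTorsionIrr`; `p` unramified in `K`)
  have hKunr : ∀ v : HeightOneSpectrum (𝓞 ℚ), (p : 𝓞 ℚ) ∈ v.asIdeal →
      Algebra.IsUnramifiedIn (𝓞 K) v.asIdeal := isUnramifiedIn_of_ncard_primesOver_eq_two hK.1 hp hsplit
  have htor : ∀ k' : ℕ, k' ≠ 0 → ¬ p ∣ k' →
      ∀ (n' : ℕ) (a : (W.baseChange (ringClassField K ι k')).toAffine.Point),
        ((p ^ n' : ℕ) : ℤ) • a = 0 → a = 0 := by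
    intro k' hk' hpk' n' a ha
    have hbot := NoTorsionIrr.torsionBy_pow_ringClassField_eq_bot_of_hasIrreducibleModPGaloisRep W hK ι hk' hp hp2
      hirr (W.exists_weilPairing_holds p) hKunr hpk' n'
    have hmem : a ∈ AddSubgroup.torsionBy (W.baseChange (ringClassField K ι k')).toAffine.Point ((p ^ n' : ℕ) : ℤ) :=
      (Submodule.mem_torsionBy_iff _ _).mpr ha
    rwa [hbot, AddSubgroup.mem_bot] at hmem
  exact padicValNat_card_sha_primary_add_le_of_globalDivisibility_ofImage hCT h372 hK hD3 hD4 hH h2 hp2 hIz hIs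
    hIc hIt ι htor Dt d₁ hPd hnt hM₀div hM₀max t hglob

end Summit.BirchSwinnertonDyer.BirchSwinnertonDyer.Theorems.ModularHeegnerCha

end
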